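import Mathlib
import HarnessLib
import HarnessLib.Audit
import Summits.CriticalPhenomena.Statement
import HarnessLib.Audit.Status.Attr

/-!
Route: LeeYangGap

# Route LeeYangGap — Lee–Yang telemetry — clause (iii) on Z^3 is one zero of the critical block-spin
characteristic function at the fluctuation scale, reached from beta < beta_c by monotone zero motion

It suffices to show X_LY = (GAP) ∧ (EDGE) ∧ (MoebLim), realising idea card
lee-yang-gap-nontriviality (which absorbed
lee-yang-first-zero-variance-share). Everything lives in ONE measure, the infinite-volume state
⟨·⟩_β = plusExpect 3 β 0
(unique for β ≤ β_c(3)); M_L := Σ_{x ∈ box 3 L} σ_x is the block spin, Σ_L := ⟨M_L²⟩_{β_c}, and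
φ_{L,β}(θ) := ⟨cos(θ M_L)⟩_β
is the block characteristic function, whose real zeros ±θ_j(L,β) are the Lee–Yang zeros of the
critical system with an
imaginary field switched on inside the box only.
(GAP) = NearCriticalLeeYangGap [crux r2]: for some C and infinitely many L there are β ∈ [0, β_c]
and a zero θ > 0 of
φ_{L,β} with θ²·Σ_L ≤ C — "the Yang–Lee gap of a critical box closes at the rate of the inverse
magnetisation
fluctuation". By Camia–Jiang–Newman monotonicity (first zero antitone in β, support
FirstZeroAntitoneInBeta +
MonotonicityTransfer) the zero may be produced at ANY β ≤ β_c, e.g. at β_L ↑ β_c with ξ(β_L) ≍ L,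
where the subcritical
toolbox applies; Newman's identity −U₄(M_L) = 12 Σ_j θ_j(L,β_c)⁻⁴ (support NewmanFirstZeroBound)
turns the zero into
limsup_L g_L > 0 for the block Binder coupling g_L := (3Σ_L² − ⟨M_L⁴⟩)/Σ_L², and support
GaussianLimitKillsBlockCoupling
shows that a pointwise scale-covariant limit with U₄^S ≡ 0 would force g_L → 0.
(EDGE) = YangLeeEdgeHyperscaling [crux r3]: θ_e(β)²·χ(β)·ξ(β)³ ≤ C as β ↑ β_c, θ_e = Yang–Lee edge
(analyticity
half-width of m(β,·) around the imaginary axis, = lim of first zeros by Jiang–Newman 2023) — the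
thermodynamic form of
non-triviality and the designated layer-2 parent link of (GAP) (see Two-layer plan); it is not an
antecedent of the
Assembly at open.
(MoebLim) = MoebiusLimitExists [crux r4, imported complement shared with route PerfectScreening]:
the conjunct minus (iii).
Lean: `(∃ C : ℝ, ∃ᶠ L : ℕ in Filter.atTop, ∃ β θ : ℝ, 0 ≤ β ∧ β ≤
Literature.Probability.LatticeModels.criticalBeta 3 ∧ 0 < θ ∧ θ ^ 2 *
Literature.Probability.LatticeModels.plusExpect 3 (Literature.Probability.LatticeModels.criticalBeta
3) 0 (fun σ => (∑ x ∈ Literature.Probability.LatticeModels.box 3 L,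
Literature.Probability.LatticeModels.spinAt x σ) ^ 2) ≤ C ∧
Literature.Probability.LatticeModels.plusExpect 3 β 0 (fun σ => Real.cos (θ * ∑ x ∈
Literature.Probability.LatticeModels.box 3 L, Literature.Probability.LatticeModels.spinAt x σ)) = 0)
∧ (∃ C β₀ : ℝ, β₀ < Literature.Probability.LatticeModels.criticalBeta 3 ∧ ∀ β θ : ℝ, β₀ ≤ β → β <
Literature.Probability.LatticeModels.criticalBeta 3 → 0 < θ → (∃ F : ℂ → ℂ, DifferentiableOn ℂ F {z
: ℂ | |z.im| < θ} ∧ ∀ h : ℝ, 0 ≤ h → F (h : ℂ) =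
((Literature.Probability.LatticeModels.magnetizationInField 3 β h : ℝ) : ℂ)) → θ ^ 2 *
(Literature.Probability.LatticeModels.susceptibility 3 β).toReal *
Literature.Probability.LatticeModels.isingCorrLength 3 β ^ 3 ≤ C) ∧ (∃ (ρ : ℝ → ℝ) (Δ : ℝ) (S :
Literature.Probability.LatticeModels.CorrFamily 3), (∀ δ ∈ Set.Ioc (0:ℝ) 1, 0 < ρ δ) ∧ 0 < Δ ∧
Literature.Probability.LatticeModels.HasPointwiseScalingLimit
(Literature.Probability.LatticeModels.criticalCorr 3) ρ S ∧
Literature.Probability.LatticeModels.IsNondegenerateTwoPoint S ∧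
Literature.Probability.LatticeModels.IsMoebiusCovariant Δ S)`

## Assembly
Pure logic plus positivity of Σ_L (blockVariance_pos), VERIFIED sorry-free as `assembly_glue` in the
planner's
SketchGlue.lean (axioms propext/choice/Quot.sound): take (ρ,Δ,S) from MoebLim; by_contra
¬HasNontrivialU4 S;
GaussianLimitKillsBlockCoupling (fed IsMoebiusCovariant.2.1) gives g_L → 0, so eventually g_L <
12/C²; GAP gives, frequently
in L, (β, θ) with θ²Σ_L ≤ C (forcing C > 0); MonotonicityTransfer(FirstZeroAntitoneInBeta) moves the
zero to some
θ' ≤ θ at β_c; NewmanFirstZeroBound gives 12/θ'⁴ ≤ 3Σ_L² − ⟨M_L⁴⟩, hence g_L ≥ 12/(θ'²Σ_L)² ≥ 12/C²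
— contradiction on a
common L (Frequently.and_eventually). EDGE is not an antecedent (layer-2 parent link of GAP, see
Two-layer plan).

Rationale: WHY THIS LINE. Interaction ⟺ one zero of an entire function at distance O(1) from the origin: for a
Lee–Yang-class law all zeros of
E e^{zX} are imaginary and E e^{zX} = Π_j(1 + z²/t_j²) (bounded X), so Var X = 2Σt_j⁻², κ₄ =
−12Σt_j⁻⁴ and
12t₁⁻⁴ ≤ |κ₄| ≤ 6t₁⁻² (Newman1975; JiangNewman2023 eq. for u_2k): the normalised critical block spin
is non-Gaussian along
a subsequence iff its first zero t₁(L) = θ₁(L)·Σ_L^{1/2} stays bounded. What the card adds, and what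
the 2022–23
Lee–Yang papers found during this session make rigorous, is a MONOTONE BRIDGE from the subcritical
phase to β_c: the
first zero of ⟨exp[hΣλ_uσ_u]⟩ is antitone in every coupling for any weights λ ≥ 0
(CamiaJiangNewman2023 Thm 2, proving the
Nishimori–Griffiths conjecture via monotonicity of Ursell functions, Shlosman1986 signs), antitone
in the block (same
proof), and the full-box first zero decreases to the analyticity radius θ_e(β) of the free energy,
positive iff β < β_c
(JiangNewman2023 Thm 1 with Ott2019); hence θ_e(β) ≤ θ₁(L,β) ≤ α₁(Λ_L,β) ↓ θ_e(β) and θ₁(L,β_c) ≤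
θ₁(L,β) for β < β_c — an
inequality in the right direction for free, where relating β ↑ β_c to finite size at β_c normally
costs a finite-size-scaling
hypothesis. The d = 3 content is then one UPPER bound on a Yang–Lee gap, attacked on the subcritical
side where the n.n.
model is best understood (sharp length and OZ structure, DuminilcopinPanis2025 = arXiv:2404.05700;
analyticity Ott2019;
Lebowitz1972 bounds), with EDGE ⟸ liminf_β χ₄/(χ²ξ³) > 0 by Newman's θ_e² ≤ 6χ/χ₄. Imported areas:
entire-function theory
(Hadamard products, Hurwitz, zero counting per period) and Lee–Yang/correlation-inequality
technology; regular variation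
(Karamata/Potter, in-tree IsSlowlyVarying) for the transfer to the pointwise U₄. Unlike the
random-current formulation of
clause (iii) (item stmt-CriticalPhenomena-0636: intersection of two current clusters) the quantity
to bound is a sum of
NONNEGATIVE terms |u_2k(M_L)| = Σ|u_2k(σ…)| read off the location of one zero; unlike
PerfectScreening it does not touch
the two-point function's shape. Negatives index (1 SAW item) not engaged; the junk-S refutations of
IsingEuclidUpgrade /
IsingCFTData are avoided because every ∀-statement over limits S here assumes non-degeneracy and
concludes a LATTICE fact.

RANKED CRUXES. #2 NearCriticalLeeYangGap (crux) — (GAP) — there is C such that for infinitely many L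
some β ∈ [0, β_c(3)] and some zero θ > 0 of θ ↦ ⟨cos(θ M_L)⟩_β satisfy θ²·⟨M_L²⟩_{β_c} ≤ C (card
items (LYG)+(FSV) merged: the yardstick is the CRITICAL block variance, so Camia–Jiang–Newman
monotonicity glues it to β_c with no variance comparison). Equivalent at β = β_c, by Newman's
identity and the 2|Λ_L|-zeros-per-period count of JiangNewman2023, to limsup_L g_L > 0 and to
factorial growth |u_2k(M_L/Σ_L^{1/2})| ≥ (2k)!·C₀^{-k} at orders k ≍ log L. [deps: none]
[difficulty: open-problem] [difficulty: open-problem] (why it might fail: At β_c it IS block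
non-Gaussianity (limsup g_L>0): false for d≥5, no d=3 lower bound on any |u_2k(M_L)| is known; the
subcritical detour only helps if block zeros reach the edge θ_e(β) already at L≍ξ(β) (layer 2),
which may fail by slowly varying factors.) [Newman1975, JiangNewman2023, CamiaJiangNewman2023,
AizenmanDuminilCopinAnnals2021, KennaLang1994, DuminilcopinPanis2025,
Literature.Barriers.CriticalPhenomena.IsingTrivialityFromDimensionFour]
#3 YangLeeEdgeHyperscaling (crux) — (EDGE) — there are C and β₀ < β_c(3) such that for β ∈ [β₀, β_c)
and every θ > 0 for which h ↦ m(β,h) (magnetizationInField, h ≥ 0) extends analytically to the strip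
|Im h| < θ, one has θ²·χ(β)·ξ(β)³ ≤ C; i.e. θ_e(β)²χ(β)ξ(β)³ stays bounded as β ↑ β_c, θ_e =
Yang–Lee edge = analyticity radius r(β) of JiangNewman2023 (the only singularities in the strip lie
on the imaginary axis by Lee–Yang). Exponent form 2Δ_gap ≥ γ + 3ν with amplitudes ('edge
hyperscaling'); implied by liminf_β χ₄/(χ²ξ³) > 0 through Newman's θ_e² ≤ 6χ/χ₄; the easy half θ_e²χ
≤ C is known. Designated layer-2 parent link of NearCriticalLeeYangGap (Two-layer plan); filed now
because it is the card's distinctive thermodynamic statement and is independently refutable. [deps: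
none] [difficulty: open-problem] [difficulty: open-problem] (why it might fail: It is hyperscaling
for the gap exponent with amplitudes: false for d≥5 (θ_e²χξ^d ~ t^{-(d-4)/2}) and for Panis's
long-range models; needs a d=3 lower bound on χ₄ (current intersections) nobody has; ξ is the liminf
axis length, amplitudes could oscillate.) [JiangNewman2023, Ott2019, Newman1975, Sokal1981,
DuminilcopinPanis2025, Panis2023Triviality,
Literature.Barriers.CriticalPhenomena.LongRangeTrivialityOnZ3]
#4 MoebiusLimitExists (crux) — (MoebLim, IMPORTED COMPLEMENT, verbatim the decl of route
PerfectScreening so the item is shared): the critical Ising correlators on Z³ have a non-degenerate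
pointwise scaling limit (ρ > 0 on (0,1], Δ > 0, S) that is Möbius covariant with dimension Δ — the
conjunct minus clause (iii). This route does not attack existence, rotations or inversion; S may be
taken 0 off NonCoincident, so no coincident-configuration junk obstructs the existential. [deps:
none] [difficulty: open-problem] [difficulty: open-problem] (why it might fail: Existence of the
full δ→0⁺ limit (all n), O(3) invariance and inversion covariance are each open on Z³ (ICM 2022
§8.4); no uniqueness mechanism in d=3; inherits ScaleCovarianceNotMoebius / LiouvilleRigidity /
BootstrapLatticeBlindness unmitigated.) [DuminilCopinICM2022 §8.1 p.25, §8.4 p.29,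
PolandRychkovVichi2019 §II eq. (2), Literature.Probability.LatticeModels.CritIsing3DEuclideanLimit,
stmt-CriticalPhenomena-1344, stmt-CriticalPhenomena-0638]
#9 FirstZeroAntitoneInBeta (support) — KNOWN (CamiaJiangNewman2023 Thm 2 with λ = indicator of box 3
L, J~ = (β'/β)·J on the free box Λ_M ⊇ Λ_L; Hurwitz/IVT to pass from 'first zero' to the filed
form): for free-boundary boxes Λ_M of Z³, L ≤ M, 0 ≤ β ≤ β', if θ > 0 is a zero of ⟨cos(θ
M_L)⟩^free_{Λ_M,β} then ⟨cos(θ' M_L)⟩^free_{Λ_M,β'} has a zero θ' ∈ (0, θ]. Port of CJN22 (random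
currents + switching lemma, in tree, + Shlosman's graph combinatorics, §2–4, ~15 pp.), or restate as
(fact →) once the cite item lands. [difficulty: L] [difficulty: L] [CamiaJiangNewman2023,
Shlosman1986, HouJiangNewman2023, LiebSokal1981]
#9 MonotonicityTransfer (support) — glue: FirstZeroAntitoneInBeta → its infinite-volume form for 0 ≤
β ≤ β' ≤ β_c(3) and blocks box 3 L in the state plusExpect (= limit of free boxes since m*(β) = 0
for β ≤ β_c: spontaneousMagnetization_criticalBeta_eq_zero_holds,
hasBoxLimit_isingCorr_of_spontaneousMagnetization_eq_zero). Sketch: φ_M → φ uniformly on compacts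
(|φ'_M| ≤ |Λ_L|); a zero θ of the limit is a limit of zeros of φ_M (Hurwitz, or elementarily:
log|φ_M| is concave between consecutive zeros by the product formula, so φ_M cannot stay zero-free
near a zero of the limit); apply the finite statement at β', extract θ'_M → θ' ∈ (0, θ] using θ'_M²
≥ 2/Var ≥ 2/|Λ_L|². [difficulty: M] [difficulty: M] [CamiaJiangNewman2023, JiangNewman2023,
HouJiangNewman2023 (Lemma 1, Hurwitz), FriedliVelenik2017 Thm 3.17]
#9 NewmanFirstZeroBound (support) — KNOWN (Newman1975 Prop 2/Thm 7; JiangNewman2023 §2 display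
u_2k(M_Λ) = (−1)^{k−1}((2k)!/k)Σ_j α_j^{−2k}, k = 2; HouJiangNewman2023 Lemma 1 for the Hadamard
product): at β_c(3), if θ > 0 is a zero of ⟨cos(θ M_L)⟩ then 12/θ⁴ ≤ 3⟨M_L²⟩² − ⟨M_L⁴⟩ (= −U₄(M_L) =
12Σ_jθ_j⁻⁴; Lee–Yang for the block law with zero weights outside the box = Newman1974 /
LiebSokal1981 §3, in tree as the named fact lee_yang_ising, or by the ε-field +
palindromic-polynomial argument; the in-tree NewmanLeeYang polynomial factorisation M(t)² = Π(1 +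
b_r sinh²t) of LongRangeTrivialityOnZ3LeeYang is the template). [difficulty: M] [difficulty: M]
[Newman1975, Newman1974, JiangNewman2023, HouJiangNewman2023, LiebSokal1981,
Literature.Probability.LatticeModels.lee_yang_circle_theorem_finite_holds]
#9 GaussianLimitKillsBlockCoupling (support) — transfer glue: if (ρ, Δ, S) is a pointwise scaling
limit of criticalCorr 3 with non-degenerate two-point function, scale covariant with dimension Δ,
and U₄^S ≡ 0 on non-coincident configurations, then g_L = (3Σ_L² − ⟨M_L⁴⟩)/Σ_L² → 0. Proof sketch
(planner NOTES): |U₄^lat| ≤ sum of pairings GG (Lebowitz + Griffiths II, coincident points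
included); Riemann sums at mesh 1/L: the ε-separated part of Σ_{Λ_L⁴}U₄ is o(L¹²ρ(1/L)⁻⁴) by locally
uniform convergence on the compact K_ε ⊂ NonCoincident while Σ_L ≥ (s₂(ε)/2)L⁶ρ⁻² by non-degeneracy;
the short-distance part is ≤ 6[V^{≤ε}_L·Σ_L + C ε³L³χ_box(2L)Σ_L] with χ_box(2L) ≤ 64χ_box(L/2)
(messager_miracleSole_holds) and V^{≤ε}_L/Σ_L ≤ 8χ_box(εL)/χ_box(L/2) → 0: the pointwise limit makes
r ↦ G(re) regularly varying of index −2Δ ∈ [−2,−1] (scalingDimension_mem_Icc_holds,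
criticalTwoPoint_bounds_holds), and Potter bounds (in-tree IsSlowlyVarying/Karamata files) give
χ_box(εL) ≤ Cε^{(3−2Δ)/2}χ_box(L). [difficulty: L] [difficulty: L] [AizenmanDuminilCopinAnnals2021
(Prop 1.4, U₄ criterion), Lebowitz1972,
Literature.Probability.LatticeModels.scalingDimension_mem_Icc_holds,
Literature.Probability.LatticeModels.messager_miracleSole_holds,
Literature.Analysis.Asymptotics.IsSlowlyVarying]

TWO-LAYER PLAN. GAP ⇐ EDGE → GapReachesEdge → CriticalWindowVariance → GAP (k = 3, depth 1), to be
filed by `route edit --split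
NearCriticalLeeYangGap` once EDGE is stamped: with β ↑ β_c and L(β) := ⌈K·ξ(β)⌉, GapReachesEdge: the
first zero of
⟨cos θM_{L(β)}⟩_β is ≤ C·θ_e(β) (a RATE in Jiang–Newman's θ₁(L,β) ↓ θ_e(β), sandwiched by θ_e ≤
θ₁(L,β) ≤ α₁(Λ_L,β) via
CJN22-in-λ; FSS lore: block zeros saturate at the edge beyond one correlation length);
CriticalWindowVariance:
Σ_{L(β)}(β_c) ≤ C·χ(β)ξ(β)³ (sharp-length finite-size scaling, DuminilcopinPanis2025). Chain:
θ₁(L,β_c) ≤ θ₁(L,β) [CJN22] ≤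
Cθ_e(β), so θ₁(L,β_c)²Σ_L(β_c) ≤ C²θ_e²·Cχξ³ ≤ C³·(EDGE const), and L(β) → ∞. Alternative child of
GAP if GapReachesEdge dies:
the high-cumulant form (|u_2k(X_L)| ≥ (2k)!C₀^{-k} at k ≍ log L, Shlosman-positive sums over
separated 2k-tuples).

KILL CRITERIA. (a) A proof of ¬GAP (t₁(L) → ∞, e.g. from an ADC-type upper bound Σ_{Λ_L⁴}|U₄| =
o(Σ_L²) in d = 3) kills the route AND,
through the U₄ criterion, clause (iii) of the conjunct itself — close
`refuted:NearCriticalLeeYangGap` and file the witness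
as negative knowledge for every U₄ route. (b) EDGE refuted (θ_e²χξ³ → ∞, e.g. from an improved tree
bound on χ₄ in d = 3)
likewise signals triviality; close. (c) GapReachesEdge refuted at layer 2 (block zeros reach the
edge only at L ≫ ξ(β) by
a power) kills the subcritical detour but not GAP: pivot GAP to the critical high-cumulant form or
close `superseded` in
favour of a U₄ route wanting stmt-CriticalPhenomena-0636. (d) FirstZeroAntitoneInBeta /
NewmanFirstZeroBound are theorems
in print: a refutation can only be a typing defect (junk conventions) — restate 1:1. (e) MoebLim
refuted moots every route
of the conjunct.

NOT DECOMPOSED YET. The layer-2 children of GAP (GapReachesEdge, CriticalWindowVariance; EDGE is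
filed); block-size monotonicity (first zero
antitone in L, Shlosman signs + CJN22 proof) and the sandwich θ_e ≤ θ₁(L,β) ≤ α₁(Λ_L,β); Lee–Yang
with zero weights
(discharge of lee_yang_ising) and the Hurwitz substitutes; Potter bounds and the Riemann-sum
bookkeeping inside
GaussianLimitKillsBlockCoupling; the FK reading ⟨e^{iθM}⟩ = E_FK Π cos(θ|C|), U₄(M) = 3Var(Σ|C|²) −
2EΣ|C|⁴ (left to card
fk-giant-cluster-lindeberg); the d ≥ 5 sanity theorem 't₁(L) → ∞' from the tree's high-dimensional
U₄ bounds; universality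
of t₁* . All are lemmas provers attach with --supports, or children filed at the split.

CHEAPEST FALSIFIER. Monte Carlo, no sign problem: ⟨cos(θ M_L)⟩ is a bounded observable. (1) At
β_c(3) = 0.2216546, blocks L = 4…24 inside
periodic boxes 4L (Wolff): locate the first zero θ₁(L) on a θ-grid and check t₁(L) =
θ₁(L)·⟨M_L²⟩^{1/2} → t₁* finite (FSS
predicts θ₁ ~ L^{-(5-η)/2}); Newman's 12/t₁⁴ ≤ g_L ≤ 6/t₁² against the known Binder cumulant is a
consistency check.
(2) At β < β_c with L = 2ξ(β), 4ξ(β): θ₁(L,β)/θ_e(β) must stay bounded as β ↑ β_c (θ_e from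
high-temperature-series
Yang–Lee-edge estimates) — growth like a power of ξ kills GapReachesEdge (Kill (c)). (3) Lookup:
existing 3D Lee–Yang-zero
FSS data (Kenna–Lang-type analyses, KennaLang1994 for d = 4 where t₁ drifts logarithmically) already
support (1). Not run in
this one-shot session (no kit budget requested); recommended as the refuter's first move.

NUMBERS. β_c(3) ≈ 0.22165463; η ≈ 0.0363, ν ≈ 0.6300, γ ≈ 1.2371, β ≈ 0.3265: Δ_gap = β+γ ≈ 1.5636
vs (γ+3ν)/2 ≈ 1.5635 (edge
hyperscaling 2Δ_gap = γ + dν ⟺ dν = 2β + γ); d = 2: 15/8 = 15/8; mean field d ≥ 5: 3/2 < 1/2 + d/4.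
Lee–Yang class:
Var X = 2Σt_j⁻², κ₄ = −12Σt_j⁻⁴, so t₁² ≥ 2 and 12t₁⁻⁴ ≤ |κ₄| ≤ 6t₁⁻² (Newman1975); u_2k(M_Λ) =
(−1)^{k−1}((2k)!/k)Σα_j^{−2k}
and Σ_jα_j^{−2k} ≤ 4|Λ|α₁^{−2k} (JiangNewman2023 §2); θ_e² ≤ 6χ/χ₄; χ₄ ≤ 2χ⁴ (tree bound); 1/2 ≤ Δ ≤
1 on Z³
(scalingDimension_mem_Icc_holds). Items at open: 8 (3 cruxes, 4 support, 1 assembly).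

DEFINITION REQUESTS. None needed for the filed signatures (plusExpect, isingExpect, box, spinAt,
criticalBeta, magnetizationInField,
susceptibility, isingCorrLength, criticalCorr and the scaling-limit predicates exist). Cite facts
wanted (filed as cite
items after open): CamiaJiangNewman2023 Thm 1 (monotonicity of Ursell functions) and Thm 2 (first
zero antitone, weights
λ ≥ 0); Shlosman1986 (signs of Ursell functions); JiangNewman2023 Thm 1 / Prop 2–3 (thermodynamic
limit of the first zero
= analyticity radius, > 0 iff β < β_c) with Ott2019 Cor 1.4. Acquisitions pending: Tasaki 1987
doi:10.1063/1.527562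
(acq-02220), Nishimori–Griffiths 1983 doi:10.1063/1.525638 (acq-02231).

Novelty: Searches (2026-08-15; local FTS/galaxy daemons were down — connection reset / queue saturated — so
the remote cascade was
used): `lit search --source crossref "motion of Lee-Yang zeros temperature dependence first zero"`
(8: Tasaki 1987
doi:10.1063/1.527562, Nishimori–Griffiths 1983 doi:10.1063/1.525638, Hou–Jiang–Newman 2023); `…
"Lee-Yang zeros monotonic
temperature ferromagnetic Ising"` (6: Kim 2004–06 densities, Kortman–Griffiths 1971, KennaLang1994);
`… "Yang-Lee edge
singularity gap exponent correlation length hyperscaling"` (8, none rigorous); `… "Lee-Yang zeros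
finite size scaling first
zero critical point cumulants"` (8: Wada–Kitazawa–Kanaya 2025 lattice-QCD FSS of LY zeros); `…
"Signs of the Ising model
Ursell functions"` (Shlosman1986, Sylvester 1975); READ in full: CamiaJiangNewman2023
(arXiv:2207.12247 §1–2),
JiangNewman2023 (arXiv:2210.03602, whole), HouJiangNewman2023 (arXiv:2208.00917 §1); plus the card's
audited prior art
(Newman1975 Thms 3/7/10, Newman 1979 Cor 2.6, LPRS, Michelen–Sahasrabudhe 2019, Deger–Brange–Flindt
2020).
Nearest prior art found: CamiaJiangNewman2023 Thm 2 + JiangNewman2023 Thm 1 (first zero antitone in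
couplings; converges to
the analyticity radius, > 0 iff β < β_c) — they complete the Lee–Yang programme for the LOCATION of
the thermodynamic
singularity but say nothing about the RATE at which α₁ closes at β_c against the fluctuation scale;
Newman1975 (zero-free
⟺ Gaussian, cumulant–zero identities); KennaLang1994 / Itzykson–Pearson–Zube  [refs: 10.1063/1.527562, 10.1063/1.525638, 2207.12247, 2210.03602, 2208.00917, doi:10.1063/1.527562, doi:10.1063/1.525638, KennaLang1994, Shlosman1986, CamiaJiangNewman2023, JiangNewman2023, HouJiangNewman2023, Newman1975, Sokal1981]

Barriers (technique_class: lee-yang-zero-location, correlation-inequality): - technique_class: lee-yang-zero-location, correlation-inequality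
- Literature.Barriers.CriticalPhenomena.IsingTrivialityFromDimensionFour: APPLIES to every
dimension-uniform step, and the route isolates them: Lee–Yang, Newman's identities, CJN22
monotonicity, JN23, and the transfer GaussianLimitKillsBlockCoupling hold verbatim in all d ≥ 2
(supports); the d-specific input sits exactly in the cruxes GAP and EDGE, both FALSE for d ≥ 5
(t₁(L) → ∞ like the inverse Binder coupling; θ_e²χξ^d ~ t^{−(d−4)/2}), so no dimension-uniform proof
of them can exist and none is attempted — their intended inputs (sharp length / OZ structure of the
subcritical n.n. model on Z³, current-intersection lower bounds) are d = 3 statements.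
- Literature.Barriers.CriticalPhenomena.LongRangeTrivialityOnZ3: APPLIES to interaction-uniform
arguments on Z³: Lee–Yang, GHS, CJN22 (any ferromagnetic pair interaction) and Newman hold for
Panis's reflection-positive |x|^{-3-α} models, whose critical limits are Gaussian for α ≤ 3/2, so
GAP/EDGE analogues fail there; a proof must use finite range — located in EDGE's ξ (exponential
decay with a renewal/OZ structure below β_c, unavailable for algebraic couplings) and in the layer-2
FSS links; recorded as kill criterion (b)/(c).
- Literature.Barriers.CriticalPhenomena.LaceExpansionIsingAboveFour: not met — no expansion, no
bubble condition; the bubble diverges in d = 3 and nothing here needs its convergence.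
- Literature.Barriers.CriticalPhenomena.BootstrapLatticeBl

Novelty grade: new-combination — ROUTE REVIEW (refuter, 2026-08-15): all 8 decls elaborate (rc0); no vacuous/junk-satisfiable item; per-item briefings stamped on 4945–4951. Novelty: the equivalence 'critical block spin non-Gaussian ⟺ first Lee–Yang zero stays O(Σ_L^{-1/2})' is Newman 1975 (Var = 2Σt_j⁻², κ₄ = −12Σt_j⁻⁴) applied to  (refuter refuter-rreview-route-AtomisticToContinu-a8207b56-0, 2026-08-15T14:01:42Z; prior: arXiv:2207.12247 (CamiaJiangNewman2023 Thm 2), arXiv:2210.03602 (JiangNewman2023 Thm 1), Newman1975 CMP 41 (zero-free <=> Gaussian; cumulant-zero identities), AizenmanDuminilCopin2021 (U4 criterion), KennaLang1994 (LY-zero FSS, d=4, non-rigorous))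

sub-problem: Ising3DConformalLimit · status: open · opened planner-plancard-CriticalPhenomena-Ising3DCon-bb511447-0 2026-08-15T11:35:52Z · rev 4 · ledger route-CriticalPhenomena-LeeYangGap
GENERATED by the gate from the ledger (D-0016/17). Provers cite these decls: `theorem foo : Summit.CriticalPhenomena.Ising3DConformalLimit.Theses.LeeYangGap.<Decl> := …` in Summits/CriticalPhenomena/Ising3DConformalLimit/Theorems/<Name>.lean.
-/

namespace Summit.CriticalPhenomena.Ising3DConformalLimit.Theses.LeeYangGap

open scoped BigOperators Topology Manifold Classical MeasureTheory ProbabilityTheory Matrix InnerProductSpace ComplexConjugate ContinuousMap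
open Filter Set Function TopologicalSpace MeasureTheory

attribute [summit_statement] _root_.Ising3DConformalLimit

/-- item stmt-CriticalPhenomena-4945 · crux · rank 2 · open · by planner
why it might fail: By CJN antitonicity GAP ⟺ liminf_L t₁(L,β_c) < ∞ ⟺ limsup_L g_L(β_c) > 0, block non-Gaussianity at β_c on Z³: false for d ≥ 5 and d = 4 (ADC21), open in d = 3, no lower bound on any |u₂ₖ(M_L)| known; the subcritical detour needs block zeros at the edge θ_e(β) for L ≍ ξ(β); logs break θ²Σ_L ≤ C.
sources: Newman1975, JiangNewman2023, CamiaJiangNewman2023, AizenmanDuminilCopinAnnals2021, Aizenman1982, KennaLang1994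
[crux] (GAP) — there is C such that for infinitely many L some β ∈ [0, β_c(3)] and some zero θ > 0
of θ ↦ ⟨cos(θ M_L)⟩_β satisfy θ²·⟨M_L²⟩_{β_c} ≤ C (card items (LYG)+(FSV) merged: the yardstick is
the CRITICAL block variance, so Camia–Jiang–Newman monotonicity glues it to β_c with no variance
comparison). Equivalent at β = β_c, by Newman's identity and the 2|Λ_L|-zeros-per-period count of
JiangNewman2023, to limsup_L g_L > 0 and to factorial growth |u_2k(M_L/Σ_L^{1/2})| ≥ (2k)!·C₀^{-k}
at orders k ≍ log L. [deps: none] [difficulty: open-problem] [difficulty: open-problem] -/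
@[route_item "route-CriticalPhenomena-LeeYangGap", crux]
def NearCriticalLeeYangGap : Prop :=
  ∃ C : ℝ, ∃ᶠ L : ℕ in Filter.atTop, ∃ β θ : ℝ, 0 ≤ β ∧ β ≤ Literature.Probability.LatticeModels.criticalBeta 3 ∧ 0 < θ ∧ θ ^ 2 * Literature.Probability.LatticeModels.plusExpect 3 (Literature.Probability.LatticeModels.criticalBeta 3) 0 (fun σ => (∑ x ∈ Literature.Probability.LatticeModels.box 3 L, Literature.Probability.LatticeModels.spinAt x σ) ^ 2) ≤ C ∧ Literature.Probability.LatticeModels.plusExpect 3 β 0 (fun σ => Real.cos (θ * ∑ x ∈ Literature.Probability.LatticeModels.box 3 L, Literature.Probability.LatticeModels.spinAt x σ)) = 0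

/-- item stmt-CriticalPhenomena-4946 · crux · rank 3 · open · by planner
why it might fail: Amplitude form of 2Δ_gap ≥ γ+3ν (edge hyperscaling ⟸ dν = 2β+γ, no logs): false for d ≥ 5 (θ_e²χξ^d ~ t^{-(d-4)/2}) and for RP long-range models on Z³ with α ≤ 3/2; needs a d = 3 lower bound on |χ₄|/(χ²ξ³) (current intersections) nobody has; ξ = liminf axis length, amplitudes may oscillate at β_c.
sources: JiangNewman2023, Ott2019, Newman1975, Sokal1981, DuminilcopinPanis2025, Panis2023Triviality
[crux] (EDGE) — there are C and β₀ < β_c(3) such that for β ∈ [β₀, β_c) and every θ > 0 for which h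
↦ m(β,h) (magnetizationInField, h ≥ 0) extends analytically to the strip |Im h| < θ, one has
θ²·χ(β)·ξ(β)³ ≤ C; i.e. θ_e(β)²χ(β)ξ(β)³ stays bounded as β ↑ β_c, θ_e = Yang–Lee edge = analyticity
radius r(β) of JiangNewman2023 (the only singularities in the strip lie on the imaginary axis by
Lee–Yang). Exponent form 2Δ_gap ≥ γ + 3ν with amplitudes ('edge hyperscaling'); implied by liminf_β
χ₄/(χ²ξ³) > 0 through Newman's θ_e² ≤ 6χ/χ₄; the easy half θ_e²χ ≤ C is known. Designated layer-2
parent link of NearCriticalLeeYangGap (Two-layer plan); filed now because it is the card's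
distinctive thermodynamic statement and is independently refutable. [deps: none] [difficulty:
open-problem] [difficulty: open-problem] -/
@[route_item "route-CriticalPhenomena-LeeYangGap", crux]
def YangLeeEdgeHyperscaling : Prop :=
  ∃ C β₀ : ℝ, β₀ < Literature.Probability.LatticeModels.criticalBeta 3 ∧ ∀ β θ : ℝ, β₀ ≤ β → β < Literature.Probability.LatticeModels.criticalBeta 3 → 0 < θ → (∃ F : ℂ → ℂ, DifferentiableOn ℂ F {z : ℂ | |z.im| < θ} ∧ ∀ h : ℝ, 0 ≤ h → F (h : ℂ) = ((Literature.Probability.LatticeModels.magnetizationInField 3 β h : ℝ) : ℂ)) → θ ^ 2 * (Literature.Probability.LatticeModels.susceptibility 3 β).toReal * Literature.Probability.LatticeModels.isingCorrLength 3 β ^ 3 ≤ C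

/-- item stmt-CriticalPhenomena-1344 · crux · rank 4 · open · by planner
why it might fail: Existence of the full δ→0⁺ limit (one ρ, all n, locally uniform on NonCoincident), O(3) invariance and inversion covariance are each open on Z³ (ICM 2022 §8.4); no uniqueness mechanism in d = 3; scale ⇏ Möbius (ScaleCovarianceNotMoebius); LiouvilleRigidity, BootstrapLatticeBlindness unmitigated.
sources: DuminilCopinICM2022 §8.1 p.25 and §8.4 p.29, PolandRychkovVichi2019 §II eq. (2), Literature.Probability.LatticeModels.CritIsing3DEuclideanLimit, Literature.Barriers.CriticalPhenomena.ScaleCovarianceNotMoebius, Literature.Barriers.CriticalPhenomena.LiouvilleRigidity, Literature.Barriers.CriticalPhenomena.BootstrapLatticeBlindness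
[crux] r5 = MoebLim (IMPORTED COMPLEMENT, lowest rank): the critical Ising correlators on ℤ³ have a
non-degenerate pointwise scaling limit (ρ > 0 on (0,1], Δ > 0, S) that is Möbius covariant with
dimension Δ — the conjunct Ising3DConformalLimit minus clause (iii). Written verbatim as the
conjunct's definiens without '∧ HasNontrivialU4 S' so that other routes filing the same complement
attach here. This route does not attack existence, rotation or inversion covariance; it bets on the
covariance lines (IsingEuclidUpgrade r5/r6 = items 0637/0638, IsingCFTData r2 = 0665, cards
hyperoctahedral-rp-rigidity / inversion-first-moebius-from-translations). S may be taken 0 off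
NonCoincident, so no coincident-configuration junk obstructs the existential. -/
@[route_item "route-CriticalPhenomena-LeeYangGap", crux]
def MoebiusLimitExists : Prop :=
  ∃ (ρ : ℝ → ℝ) (Δ : ℝ) (S : Literature.Probability.LatticeModels.CorrFamily 3), (∀ δ ∈ Set.Ioc (0:ℝ) 1, 0 < ρ δ) ∧ 0 < Δ ∧ Literature.Probability.LatticeModels.HasPointwiseScalingLimit (Literature.Probability.LatticeModels.criticalCorr 3) ρ S ∧ Literature.Probability.LatticeModels.IsNondegenerateTwoPoint S ∧ Literature.Probability.LatticeModels.IsMoebiusCovariant Δ S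

/-- item stmt-CriticalPhenomena-4947 · support · rank 9 · closed · proved by Summit.CriticalPhenomena.Ising3DConformalLimit.Theorems.firstZeroAntitoneInBeta_proof (prover) · by planner
sources: CamiaJiangNewman2023 Thm 2, Shlosman1986, HouJiangNewman2023, LiebSokal1981
[support] KNOWN (CamiaJiangNewman2023 Thm 2 with λ = indicator of box 3 L, J~ = (β'/β)·J on the free
box Λ_M ⊇ Λ_L; Hurwitz/IVT to pass from 'first zero' to the filed form): for free-boundary boxes Λ_M
of Z³, L ≤ M, 0 ≤ β ≤ β', if θ > 0 is a zero of ⟨cos(θ M_L)⟩^free_{Λ_M,β} then ⟨cos(θ'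
M_L)⟩^free_{Λ_M,β'} has a zero θ' ∈ (0, θ]. Port of CJN22 (random currents + switching lemma, in
tree, + Shlosman's graph combinatorics, §2–4, ~15 pp.), or restate as (fact →) once the cite item
lands. [difficulty: L] [difficulty: L] -/
@[route_item "route-CriticalPhenomena-LeeYangGap", crux]
def FirstZeroAntitoneInBeta : Prop :=
  ∀ (M L : ℕ) (β β' θ : ℝ), L ≤ M → 0 ≤ β → β ≤ β' → 0 < θ → Literature.Probability.LatticeModels.isingExpect (Literature.Probability.LatticeModels.zdGraph 3) (Literature.Probability.LatticeModels.box 3 M) β 0 Literature.Probability.LatticeModels.BoundaryCondition.free (fun σ => Real.cos (θ * ∑ x ∈ Literature.Probability.LatticeModels.box 3 L, Literature.Probability.LatticeModels.spinAt x σ)) = 0 → ∃ θ' : ℝ, 0 < θ' ∧ θ' ≤ θ ∧ Literature.Probability.LatticeModels.isingExpect (Literature.Probability.LatticeModels.zdGraph 3) (Literature.Probability.LatticeModels.box 3 M) β' 0 Literature.Probability.LatticeModels.BoundaryCondition.free (fun σ => Real.cos (θ' * ∑ x ∈ Literature.Probability.LatticeModels.box 3 L, Literature.Probability.LatticeModels.spinAt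 x σ)) = 0

/-- item stmt-CriticalPhenomena-4948 · support · rank 9 · closed · proved by Summit.CriticalPhenomena.Ising3DConformalLimit.Theorems.monotonicityTransfer_proof @ 683a8e7cca29 (prover) · by planner
sources: CamiaJiangNewman2023, JiangNewman2023, HouJiangNewman2023 Lemma 1 (Hurwitz), FriedliVelenik2017 Thm 3.17, Literature.Probability.LatticeModels.spontaneousMagnetization_criticalBeta_eq_zero_holds, Literature.Probability.LatticeModels.hasBoxLimit_isingCorr_of_spontaneousMagnetization_eq_zero
[support] glue: FirstZeroAntitoneInBeta → its infinite-volume form for 0 ≤ β ≤ β' ≤ β_c(3) and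
blocks box 3 L in the state plusExpect (= limit of free boxes since m*(β) = 0 for β ≤ β_c:
spontaneousMagnetization_criticalBeta_eq_zero_holds,
hasBoxLimit_isingCorr_of_spontaneousMagnetization_eq_zero). Sketch: φ_M → φ uniformly on compacts
(|φ'_M| ≤ |Λ_L|); a zero θ of the limit is a limit of zeros of φ_M (Hurwitz, or elementarily:
log|φ_M| is concave between consecutive zeros by the product formula, so φ_M cannot stay zero-free
near a zero of the limit); apply the finite statement at β', extract θ'_M → θ' ∈ (0, θ] using θ'_M²
≥ 2/Var ≥ 2/|Λ_L|². [difficulty: M] [difficulty: M] -/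
@[route_item "route-CriticalPhenomena-LeeYangGap", crux]
def MonotonicityTransfer : Prop :=
  (∀ (M L : ℕ) (β β' θ : ℝ), L ≤ M → 0 ≤ β → β ≤ β' → 0 < θ → Literature.Probability.LatticeModels.isingExpect (Literature.Probability.LatticeModels.zdGraph 3) (Literature.Probability.LatticeModels.box 3 M) β 0 Literature.Probability.LatticeModels.BoundaryCondition.free (fun σ => Real.cos (θ * ∑ x ∈ Literature.Probability.LatticeModels.box 3 L, Literature.Probability.LatticeModels.spinAt x σ)) = 0 → ∃ θ' : ℝ, 0 < θ' ∧ θ' ≤ θ ∧ Literature.Probability.LatticeModels.isingExpect (Literature.Probability.LatticeModels.zdGraph 3) (Literature.Probability.LatticeModels.box 3 M) β' 0 Literature.Probability.LatticeModels.BoundaryCondition.free (fun σ => Real.cos (θ' * ∑ x ∈ Literature.Probability.LatticeModels.box 3 L, Literature.Probability.LatticeModels.spinAt x σ)) = 0) → ∀ (L : ℕ) (β β' θ : ℝ), 0 ≤ β → β ≤ β' → β' ≤ Literature.Probability.LatticeModels.criticalBeta 3 → 0 < θ → Literature.Probability.LatticeModels.plusExpect 3 β 0 (fun σ => Real.cos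 (θ * ∑ x ∈ Literature.Probability.LatticeModels.box 3 L, Literature.Probability.LatticeModels.spinAt x σ)) = 0 → ∃ θ' : ℝ, 0 < θ' ∧ θ' ≤ θ ∧ Literature.Probability.LatticeModels.plusExpect 3 β' 0 (fun σ => Real.cos (θ' * ∑ x ∈ Literature.Probability.LatticeModels.box 3 L, Literature.Probability.LatticeModels.spinAt x σ)) = 0

/-- item stmt-CriticalPhenomena-4949 · support · rank 9 · closed · proved by Summit.CriticalPhenomena.Ising3DConformalLimit.LeeYangGapNewmanFirstZeroBound.newmanFirstZeroBound_proof @ c72aee93d46f (prover) · by planner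
sources: Newman1975 Thm 3 and eq. for u₄, Newman1974, JiangNewman2023 §2, HouJiangNewman2023 Lemma 1, LiebSokal1981 §3, Literature.Probability.LatticeModels.lee_yang_circle_theorem_finite_holds
[support] KNOWN (Newman1975 Prop 2/Thm 7; JiangNewman2023 §2 display u_2k(M_Λ) =
(−1)^{k−1}((2k)!/k)Σ_j α_j^{−2k}, k = 2; HouJiangNewman2023 Lemma 1 for the Hadamard product): at
β_c(3), if θ > 0 is a zero of ⟨cos(θ M_L)⟩ then 12/θ⁴ ≤ 3⟨M_L²⟩² − ⟨M_L⁴⟩ (= −U₄(M_L) = 12Σ_jθ_j⁻⁴;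
Lee–Yang for the block law with zero weights outside the box = Newman1974 / LiebSokal1981 §3, in
tree as the named fact lee_yang_ising, or by the ε-field + palindromic-polynomial argument; the
in-tree NewmanLeeYang polynomial factorisation M(t)² = Π(1 + b_r sinh²t) of
LongRangeTrivialityOnZ3LeeYang is the template). [difficulty: M] [difficulty: M] -/
@[route_item "route-CriticalPhenomena-LeeYangGap", crux]
def NewmanFirstZeroBound : Prop :=
  ∀ (L : ℕ) (θ : ℝ), 0 < θ → Literature.Probability.LatticeModels.plusExpect 3 (Literature.Probability.LatticeModels.criticalBeta 3) 0 (fun σ => Real.cos (θ * ∑ x ∈ Literature.Probability.LatticeModels.box 3 L, Literature.Probability.LatticeModels.spinAt x σ)) = 0 → 12 / θ ^ 4 ≤ 3 * (Literature.Probability.LatticeModels.plusExpect 3 (Literature.Probability.LatticeModels.criticalBeta 3) 0 (fun σ => (∑ x ∈ Literature.Probability.LatticeModels.box 3 L, Literature.Probability.LatticeModels.spinAt x σ) ^ 2)) ^ 2 - Literature.Probability.LatticeModels.plusExpect 3 (Literature.Probability.LatticeModels.criticalBeta 3) 0 (fun σ => (∑ x ∈ Literature.Probability.LatticeModels.box 3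 L, Literature.Probability.LatticeModels.spinAt x σ) ^ 4)

/-- item stmt-CriticalPhenomena-4950 · support · rank 9 · closed · proved by Summit.CriticalPhenomena.Ising3DConformalLimit.LeeYangGapGaussianLimitKillsBlockCoupling.gaussianLimitKillsBlockCoupling_proof @ ec37b60e67a1 (prover) · by planner
sources: AizenmanDuminilCopinAnnals2021 Prop 1.4 (U₄ criterion), Lebowitz1972, Literature.Probability.LatticeModels.scalingDimension_mem_Icc_holds, Literature.Probability.LatticeModels.messager_miracleSole_holds, Literature.Probability.LatticeModels.criticalTwoPoint_bounds_holds, Literature.Analysis.Asymptotics.IsSlowlyVarying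
[support] transfer glue: if (ρ, Δ, S) is a pointwise scaling limit of criticalCorr 3 with
non-degenerate two-point function, scale covariant with dimension Δ, and U₄^S ≡ 0 on non-coincident
configurations, then g_L = (3Σ_L² − ⟨M_L⁴⟩)/Σ_L² → 0. Proof sketch (planner NOTES): |U₄^lat| ≤ sum
of pairings GG (Lebowitz + Griffiths II, coincident points included); Riemann sums at mesh 1/L: the
ε-separated part of Σ_{Λ_L⁴}U₄ is o(L¹²ρ(1/L)⁻⁴) by locally uniform convergence on the compact K_ε ⊂
NonCoincident while Σ_L ≥ (s₂(ε)/2)L⁶ρ⁻² by non-degeneracy; the short-distance part is ≤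
6[V^{≤ε}_L·Σ_L + C ε³L³χ_box(2L)Σ_L] with χ_box(2L) ≤ 64χ_box(L/2) (messager_miracleSole_holds) and
V^{≤ε}_L/Σ_L ≤ 8χ_box(εL)/χ_box(L/2) → 0: the pointwise limit makes r ↦ G(re) regularly varying of
index −2Δ ∈ [−2,−1] (scalingDimension_mem_Icc_holds, criticalTwoPoint_bounds_holds), and Potter
bounds (in-tree IsSlowlyVarying/Karamata files) give χ_box(εL) ≤ Cε^{(3−2Δ)/2}χ_box(L). [difficulty:
L] [difficulty: L] -/
@[route_item "route-CriticalPhenomena-LeeYangGap", crux]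
def GaussianLimitKillsBlockCoupling : Prop :=
  ∀ (ρ : ℝ → ℝ) (Δ : ℝ) (S : Literature.Probability.LatticeModels.CorrFamily 3), (∀ δ ∈ Set.Ioc (0:ℝ) 1, 0 < ρ δ) → Literature.Probability.LatticeModels.HasPointwiseScalingLimit (Literature.Probability.LatticeModels.criticalCorr 3) ρ S → Literature.Probability.LatticeModels.IsNondegenerateTwoPoint S → Literature.Probability.LatticeModels.IsScaleCovariant Δ S → ¬ Literature.Probability.LatticeModels.HasNontrivialU4 S → Filter.Tendsto (fun L : ℕ => (3 * (Literature.Probability.LatticeModels.plusExpect 3 (Literature.Probability.LatticeModels.criticalBeta 3) 0 (fun σ => (∑ x ∈ Literature.Probability.LatticeModels.box 3 L, Literature.Probability.LatticeModels.spinAt x σ) ^ 2)) ^ 2 - Literature.Probability.LatticeModels.plusExpect 3 (Literature.Probability.LatticeModels.criticalBeta 3) 0 (fun σ => (∑ x ∈ Literature.Probability.LatticeModels.box 3 L, Literature.Probability.LatticeModels.spinAt x σ) ^ 4)) / (Literature.Probability.LatticeModels.plusExpect 3 (Literature.Probability.LatticeModels.criticalBeta 3) 0 (fun σ => (∑ x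 ∈ Literature.Probability.LatticeModels.box 3 L, Literature.Probability.LatticeModels.spinAt x σ) ^ 2)) ^ 2) Filter.atTop (nhds 0)

/-- item stmt-CriticalPhenomena-4951 · assembly · rank 1 · closed · proved by Summit.CriticalPhenomena.Ising3DConformalLimit.Theorems.leeYangGap_assembly_proof (prover) · by planner
sources: Newman1975, CamiaJiangNewman2023, idea card Summits/CriticalPhenomena/Ising3DConformalLimit/Ideas/lee-yang-gap-nontriviality.md
[assembly] NearCriticalLeeYangGap → FirstZeroAntitoneInBeta → MonotonicityTransfer →
NewmanFirstZeroBound → GaussianLimitKillsBlockCoupling → MoebiusLimitExists → Ising3DConformalLimit. -/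
@[route_item "route-CriticalPhenomena-LeeYangGap", crux]
def Assembly : Prop :=
  NearCriticalLeeYangGap → FirstZeroAntitoneInBeta → MonotonicityTransfer → NewmanFirstZeroBound → GaussianLimitKillsBlockCoupling → MoebiusLimitExists → Ising3DConformalLimit

/-! D-0027 §2.1 — DECIDING THEOREM (planner-authored via `route open/edit --closes-file`; by operator:999:2941348 2026-08-15T15:23:50Z):
its hypotheses are this route's items and its conclusion the sub-problem Statement (glue_lint), and it elaborates with this file. -/

@[closes "route-CriticalPhenomena-LeeYangGap"] theorem closes : NearCriticalLeeYangGap → YangLeeEdgeHyperscaling → MoebiusLimitExists → FirstZeroAntitoneInBeta → MonotonicityTransfer → NewmanFirstZeroBound → GaussianLimitKillsBlockCoupling → Assembly → _root_.Ising3DConformalLimit := fun h_NearCriticalLeeYangGap h_YangLeeEdgeHyperscaling h_MoebiusLimitExists h_FirstZeroAntitoneInBeta h_MonotonicityTransfer h_NewmanFirstZeroBound h_GaussianLimitKillsBlockCoupling h_Assembly => h_Assembly h_NearCriticalLeeYangGap h_FirstZeroAntitoneInBeta h_MonotonicityTransfer h_NewmanFirstZeroBound h_GaussianLimitKillsBlockCoupling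 h_MoebiusLimitExists

end Summit.CriticalPhenomena.Ising3DConformalLimit.Theses.LeeYangGap
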